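import Summits.Ventures.PercRepro0.ZeroOneKolmogorov

/-!
# Lemma BOX: uniform box-to-box connections when an infinite cluster exists (seat p4, census supplement)

TMID-census-p6-v2 §5, Lemma BOX, on `Defs`: if `θ_d(p) > 0` then for every `η > 0` there is `N` such that
`P_p(Λ_N ↔ Λ_N + x) ≥ 1 − 2η` for EVERY `x ∈ ℤ^d` — at `p = p_c(d)` this is the census statement «if `T(d)` fails,
two boxes of a fixed size are joined with probability close to one however far apart they are».

Inputs: L5 (`P_existsInfCluster_eq_one_iff`: `θ_d(p) > 0 ⇒ P_p(∃ infinite cluster) = 1`), continuity of the measure along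
the increasing union `{∃ infinite cluster} = ⋃_N {Λ_N ↔ ∞}`, F2 (translations, `Invariance`), and P3 · UNIQUE as the one
hypothesis `hP3 : P3_Unique d` (a.s. at most one infinite cluster; TrifCreate.P3_Unique_all discharges it once landed).

* `connInfSet d A` = `{A ↔ ∞}`, `connSets d A B` = `{A ↔ B}` (measurable; `A`, `B` arbitrary vertex sets);
* `existsInfCluster_eq_iUnion_box`, `P_connInfSet_image` (translation invariance of `P_p(A ↔ ∞)`),
  `connInfSet_inter_subset` (`{A ↔ ∞} ∩ {B ↔ ∞} ∩ {≤ 1 infinite cluster} ⊆ {A ↔ B}`);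
* **`lemma_box`** and its form at `p_c` (`lemma_box_pc`).

Census evidence only, off every declaration path; nothing claimed on `T(d)` for any `d`.
-/

namespace Summit.Ventures.PercRepro0.BoxLemma

open MeasureTheory ProbabilityTheory unitInterval Set Filter
open Summit.Ventures.PercRepro0.Defs
open scoped ENNReal Topology

variable {d : ℕ}

/-- `{A ↔ ∞}`: some vertex of `A` lies in an infinite open cluster. -/
def connInfSet (d : ℕ) (A : Set (Vertex d)) : Set (Config d) := {ω | ∃ a ∈ A, ConnInf d ω a}

/-- `{A ↔ B}`: some vertex of `A` is joined to some vertex of `B`. -/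
def connSets (d : ℕ) (A B : Set (Vertex d)) : Set (Config d) := {ω | ∃ a ∈ A, ∃ b ∈ B, Conn d ω a b}

/-- `{A ↔ ∞}` is measurable. -/
theorem measurableSet_connInfSet (A : Set (Vertex d)) : MeasurableSet (connInfSet d A) := by
  have : connInfSet d A = ⋃ a ∈ A, {ω : Config d | ConnInf d ω a} := by
    ext ω
    simp only [connInfSet, Set.mem_setOf_eq, Set.mem_iUnion, exists_prop]
  rw [this]
  exact MeasurableSet.biUnion (Set.to_countable A) fun a _ => measurableSet_connInf a

/-- `{A ↔ B}` is measurable. -/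
theorem measurableSet_connSets (A B : Set (Vertex d)) : MeasurableSet (connSets d A B) := by
  have : connSets d A B = ⋃ a ∈ A, ⋃ b ∈ B, {ω : Config d | Conn d ω a b} := by
    ext ω
    simp only [connSets, Set.mem_setOf_eq, Set.mem_iUnion, exists_prop]
  rw [this]
  exact MeasurableSet.biUnion (Set.to_countable A) fun a _ =>
    MeasurableSet.biUnion (Set.to_countable B) fun b _ => measurableSet_conn a b

/-- Every vertex lies in some box. -/
theorem exists_mem_box (a : Vertex d) : ∃ N : ℕ, a ∈ box d N :=
  ⟨(∑ i, |a i|).toNat, fun i =>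
    (Finset.single_le_sum (fun j _ => abs_nonneg (a j)) (Finset.mem_univ i)).trans (Int.self_le_toNat _)⟩

/-- Boxes grow with `N`. -/
theorem box_mono {m n : ℕ} (h : m ≤ n) : box d m ⊆ box d n :=
  fun _ hx i => (hx i).trans (by exact_mod_cast h)

/-- `{∃ infinite cluster} = ⋃_N {Λ_N ↔ ∞}`. -/
theorem existsInfCluster_eq_iUnion_box : existsInfCluster d = ⋃ N : ℕ, connInfSet d (box d N) := by
  ext ω
  constructor
  · rintro ⟨a, ha⟩
    obtain ⟨N, hN⟩ := exists_mem_box a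
    exact Set.mem_iUnion.2 ⟨N, a, hN, ha⟩
  · intro h
    obtain ⟨N, hN⟩ := Set.mem_iUnion.1 h
    obtain ⟨a, -, ha⟩ := hN
    exact ⟨a, ha⟩

/-- `{A ↔ ∞}` is monotone in `A`. -/
theorem connInfSet_mono {A B : Set (Vertex d)} (h : A ⊆ B) : connInfSet d A ⊆ connInfSet d B :=
  fun _ ⟨a, ha, hc⟩ => ⟨a, h ha, hc⟩

/-- The translate of `{A ↔ ∞}` is `{A + z ↔ ∞}`. -/
theorem preimage_shiftConfig_connInfSet (z : Vertex d) (A : Set (Vertex d)) :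
    shiftConfig z ⁻¹' connInfSet d A = connInfSet d ((· + z) '' A) := by
  ext ω
  simp only [Set.mem_preimage, connInfSet, Set.mem_setOf_eq, Set.mem_image]
  constructor
  · rintro ⟨a, ha, h⟩
    exact ⟨a + z, ⟨a, ha, rfl⟩, (connInf_shiftConfig z ω a).1 h⟩
  · rintro ⟨b, ⟨a, ha, rfl⟩, h⟩
    exact ⟨a, ha, (connInf_shiftConfig z ω a).2 h⟩

/-- F2: `P_p(A + z ↔ ∞) = P_p(A ↔ ∞)`. -/
theorem P_connInfSet_image (p : I) (z : Vertex d) (A : Set (Vertex d)) :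
    P d p (connInfSet d ((· + z) '' A)) = P d p (connInfSet d A) := by
  rw [← preimage_shiftConfig_connInfSet, P_shiftConfig_preimage z p (measurableSet_connInfSet A)]

/-- With at most one infinite cluster, `{A ↔ ∞} ∩ {B ↔ ∞} ⊆ {A ↔ B}`. -/
theorem connInfSet_inter_subset (A B : Set (Vertex d)) :
    connInfSet d A ∩ connInfSet d B ∩ atMostOneInfCluster d ⊆ connSets d A B := by
  rintro ω ⟨⟨⟨a, ha, hA⟩, ⟨b, hb, hB⟩⟩, hU⟩
  exact ⟨a, ha, b, hb, hU a b hA hB⟩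

/-- **Lemma BOX** (TMID-census-p6-v2 §5). If `θ_d(p) > 0` and a.s. there is at most one infinite cluster, then for every
`η > 0` there is `N` with `P_p(Λ_N ↔ Λ_N + x) ≥ 1 − 2η` for every `x`. -/
theorem lemma_box (hP3 : P3_Unique d) {p : I} (hθ : 0 < thetaI d p) {η : ℝ} (hη : 0 < η) :
    ∃ N : ℕ, ∀ x : Vertex d,
      1 - 2 * η ≤ (P d p (connSets d (box d N) ((· + x) '' box d N))).toReal := by
  -- L5: `P_p(∃ infinite cluster) = 1`
  have h1 : P d p (existsInfCluster d) = 1 := (P_existsInfCluster_eq_one_iff p).2 hθ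
  -- `P_p(Λ_N ↔ ∞) → 1`
  have hmono : Monotone fun N : ℕ => connInfSet d (box d N) :=
    fun _ _ hmn => connInfSet_mono (box_mono hmn)
  have htend : Tendsto (fun N : ℕ => (P d p (connInfSet d (box d N))).toReal) atTop (𝓝 1) := by
    have h := tendsto_measure_iUnion_atTop (μ := P d p) hmono
    rw [← existsInfCluster_eq_iUnion_box, h1] at h
    have h' := (ENNReal.tendsto_toReal ENNReal.one_ne_top).comp h
    rw [ENNReal.toReal_one] at h'
    exact h'
  obtain ⟨N, hN⟩ := (htend.eventually_const_lt (by linarith : 1 - η < 1)).exists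
  refine ⟨N, fun x => ?_⟩
  have hE2 : (P d p (connInfSet d ((· + x) '' box d N))).toReal = (P d p (connInfSet d (box d N))).toReal := by
    rw [P_connInfSet_image]
  -- the complement of the good event is small
  have hUc : P d p (atMostOneInfCluster d)ᶜ = 0 := by
    rw [prob_compl_eq_one_sub measurableSet_atMostOneInfCluster, hP3 p, tsub_self]
  have hcompl : P d p (connInfSet d (box d N) ∩ connInfSet d ((· + x) '' box d N) ∩ atMostOneInfCluster d)ᶜ ≤
      P d p (connInfSet d (box d N))ᶜ + P d p (connInfSet d ((· + x) '' box d N))ᶜ := by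
    rw [Set.compl_inter, Set.compl_inter]
    calc P d p ((connInfSet d (box d N))ᶜ ∪ (connInfSet d ((· + x) '' box d N))ᶜ ∪ (atMostOneInfCluster d)ᶜ)
        ≤ P d p ((connInfSet d (box d N))ᶜ ∪ (connInfSet d ((· + x) '' box d N))ᶜ) +
            P d p (atMostOneInfCluster d)ᶜ := measure_union_le _ _
      _ = P d p ((connInfSet d (box d N))ᶜ ∪ (connInfSet d ((· + x) '' box d N))ᶜ) := by rw [hUc, add_zero]
      _ ≤ P d p (connInfSet d (box d N))ᶜ + P d p (connInfSet d ((· + x) '' box d N))ᶜ := measure_union_le _ _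
  have hc1 : (P d p (connInfSet d (box d N))ᶜ).toReal = 1 - (P d p (connInfSet d (box d N))).toReal := by
    rw [prob_compl_eq_one_sub (measurableSet_connInfSet _),
      ENNReal.toReal_sub_of_le prob_le_one ENNReal.one_ne_top, ENNReal.toReal_one]
  have hc2 : (P d p (connInfSet d ((· + x) '' box d N))ᶜ).toReal =
      1 - (P d p (connInfSet d ((· + x) '' box d N))).toReal := by
    rw [prob_compl_eq_one_sub (measurableSet_connInfSet _),
      ENNReal.toReal_sub_of_le prob_le_one ENNReal.one_ne_top, ENNReal.toReal_one]
  have hgood : (P d p (connInfSet d (box d N) ∩ connInfSet d ((· + x) '' box d N) ∩ atMostOneInfCluster d)).toReal =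
      1 - (P d p (connInfSet d (box d N) ∩ connInfSet d ((· + x) '' box d N) ∩ atMostOneInfCluster d)ᶜ).toReal := by
    rw [prob_compl_eq_one_sub (((measurableSet_connInfSet _).inter (measurableSet_connInfSet _)).inter
      measurableSet_atMostOneInfCluster), ENNReal.toReal_sub_of_le prob_le_one ENNReal.one_ne_top,
      ENNReal.toReal_one]
    ring
  have hcompl' := ENNReal.toReal_mono (ENNReal.add_ne_top.2 ⟨measure_ne_top _ _, measure_ne_top _ _⟩) hcompl
  rw [ENNReal.toReal_add (measure_ne_top _ _) (measure_ne_top _ _), hc1, hc2, hE2] at hcompl'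
  have hmono' : (P d p (connInfSet d (box d N) ∩ connInfSet d ((· + x) '' box d N) ∩ atMostOneInfCluster d)).toReal ≤
      (P d p (connSets d (box d N) ((· + x) '' box d N))).toReal :=
    ENNReal.toReal_mono (measure_ne_top _ _) (measure_mono (connInfSet_inter_subset _ _))
  linarith

/-- **Lemma BOX at `p_c`**: if `θ_d(p_c(d)) > 0` (i.e. `T(d)` fails) then for every `η > 0` some fixed box size `N` has
`P_{p_c(d)}(Λ_N ↔ Λ_N + x) ≥ 1 − 2η` for every `x` (given P3). -/
theorem lemma_box_pc (hP3 : P3_Unique d) (hθ : 0 < theta d (pc d)) {η : ℝ} (hη : 0 < η) :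
    ∃ N : ℕ, ∀ x : Vertex d,
      1 - 2 * η ≤ (P d (clamp (pc d)) (connSets d (box d N) ((· + x) '' box d N))).toReal :=
  lemma_box hP3 hθ hη

end Summit.Ventures.PercRepro0.BoxLemma
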